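import Literature.NumberTheory.CubicFields.ThreeTorsionParametrizationInvariance
import HarnessLib

/-!
# Injectivity in Bhargava's parametrization: equivalent pairs `(I, δ)` come from `SL₂(ℤ)`-equivalent forms (HCL I, Thm 13)

Topic `Literature/NumberTheory/CubicFields`, continuing `ThreeTorsionParametrizationInvariance.lean`
(`δ · θ(C ∘ γ) = (α'³, α'²β', α'β'², β'³)`). Seventh step of the class-field-theory-free road to
the Davenport–Heilbronn theorem on `Cl(K)[3]` (Bhargava–Varma 2016, §§2–3): the map
`SL₂(ℤ)\{C : disc C = D} → {(I, δ)}/∼` is injective.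

Bhargava, HCL I, Thm 13 and its proof: the orbit of `C` corresponds to the class of `(S, I, δ)`
under `(I, δ) ∼ (κI, κ³δ)`; "any binary cubic form `SL₂(ℤ)`-equivalent to `C(x, y)` can be
obtained from `(S, I, δ)` … simply by changing the basis for `I` appropriately", and conversely
the triple determines the orbit ("we have produced the unique triple up to equivalence that
yields the form `C`"). Concretely, with the representatives `I(C) = (θ₁, θ₂)` (Bhargava's `ℤθ₁ + ℤθ₂`,
extended to `𝓞 K`; equal to it for fundamental `disc C`), `δ(C) = θ₁θ₂`:
suppose `I(C') = κ I(C)` and `δ(C') = κ³ δ(C)`, written with `κ = y/x` and a transition matrix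
`M = (m₁ n₁; m₂ n₂)`, `x θ'₁ = y(m₁θ₁ + n₁θ₂)`, `x θ'₂ = y(m₂θ₁ + n₂θ₂)`, `x³ θ'₁θ'₂ = y³ θ₁θ₂`.

* `sl2zEquiv_of_transition` — if `det M = 1` then **`C' = C ∘ M`**: by the Invariance file the
  values of `C ∘ M` are `(α'³, α'²β', α'β'², β'³)/δ`, and these are the `θ'ᵢ`
  (`x α'β' = y δ` from the cube relation); equal values have equal `π`-parts;
* `false_of_transition_of_det_eq_neg_one` — **`det M = −1` is impossible**: then the values of `C'`
  would be `(ψ₀, −ψ₁, ψ₂, −ψ₃)` for `ψ = θ(C ∘ M₁)`, `M₁ = (m₁ n₁; −m₂ −n₂) ∈ SL₂(ℤ)`, forcing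
  `C' = (C ∘ M₁) ∘ diag(1, −1)` and then, by the weight-`3` covariance of `g`
  (`gCov_subst` with `det = −1`), `g(C ∘ M₁) = 0`, so `disc(C)³ = disc(g) = 0` — contradicting
  `disc C` non-square. (This is where the ORIENTATION enters: `GL₂(ℤ) ∖ SL₂(ℤ)` swaps a triple
  with its conjugate, Bhargava–Varma Cor. 11.)
* `sl2zEquiv_of_transition_of_isUnit` — the two cases together: `det M = ±1 ⟹ C ∼ C'`.

All statements are proved (field-level: `K ∋ s`, `s² = disc C = disc C'` non-square). The
translation from an equality of ideal classes `(x) I(C') = (y) I(C)` in `𝓞 K` to a transition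
matrix `M ∈ GL₂(ℤ)` is in the sequel.

## References

* M. Bhargava, *Higher composition laws I*, Ann. of Math. 159 (2004), §3.4, Thm 13 and its proof
  [Bhargava2004HCL1].
* M. Bhargava, I. Varma, Proc. LMS 112 (2016) = arXiv:1401.5875, Thm 9 and Cor. 11
  [BhargavaVarma2016].
-/

namespace Literature.NumberTheory.CubicFields

namespace SymCubic

variable {K : Type*} [Field K] [CharZero K]

/-- Equal values have equal `π`-parts: if `θᵢ(C') = θᵢ(C'')` (same `s`, `s² = D` non-square) then
`aᵢ(C') = aᵢ(C'')`, and likewise for the `g`-parts; with opposite values, opposite parts. [folklore] -/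
theorem parts_eq_of_thetaForm_eq {D : ℤ} (hD : ¬ IsSquare D) {s : K} (hs : s ^ 2 = (D : K))
    {g a g' a' : ℤ} (h : ((g : K) + (a : K) * s) / 2 = ((g' : K) + (a' : K) * s) / 2) :
    a = a' ∧ g = g' := by
  have h' : ((g - g' : ℤ) : K) + ((a - a' : ℤ) : K) * s = 0 := by
    push_cast; linear_combination 2 * h
  obtain ⟨ha, hg⟩ := eq_zero_of_intCast_add_mul_eq_zero hD hs h'
  exact ⟨by omega, by omega⟩

/-- Opposite values: `θ = −θ''` forces `a = −a''`, `g = −g''`. [folklore] -/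
theorem parts_eq_neg_of_thetaForm_eq_neg {D : ℤ} (hD : ¬ IsSquare D) {s : K} (hs : s ^ 2 = (D : K))
    {g a g' a' : ℤ} (h : ((g : K) + (a : K) * s) / 2 = -(((g' : K) + (a' : K) * s) / 2)) :
    a = -a' ∧ g = -g' := by
  have h' : ((g + g' : ℤ) : K) + ((a + a' : ℤ) : K) * s = 0 := by
    push_cast; linear_combination 2 * h
  obtain ⟨ha, hg⟩ := eq_zero_of_intCast_add_mul_eq_zero hD hs h'
  exact ⟨by omega, by omega⟩

section Transition

variable (C C' : SymCubic ℤ) {s : K} (hs : s ^ 2 = (C.disc : K)) (hdisc : C'.disc = C.disc)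
  (hD : ¬ IsSquare C.disc) (m₁ n₁ m₂ n₂ : ℤ) {x y : K} (hx : x ≠ 0) (hy : y ≠ 0)
  (h₁ : x * (C'.thetaForm s).a₁ = y * ((m₁ : K) * (C.thetaForm s).a₁ + (n₁ : K) * (C.thetaForm s).a₂))
  (h₂ : x * (C'.thetaForm s).a₂ = y * ((m₂ : K) * (C.thetaForm s).a₁ + (n₂ : K) * (C.thetaForm s).a₂))
  (hδ : x ^ 3 * ((C'.thetaForm s).a₁ * (C'.thetaForm s).a₂)
    = y ^ 3 * ((C.thetaForm s).a₁ * (C.thetaForm s).a₂))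
include hs hdisc hD hx hy h₁ h₂ hδ

omit [CharZero K] hs hdisc hD hx in
/-- The cube relation `x³δ' = y³δ` together with `xθ'₁ = yα'`, `xθ'₂ = yβ'` gives
**`x α'β' = y δ`** (`δ = θ₁θ₂`). [folklore] -/
theorem x_mul_basis_eq :
    x * (((m₁ : K) * (C.thetaForm s).a₁ + (n₁ : K) * (C.thetaForm s).a₂)
      * ((m₂ : K) * (C.thetaForm s).a₁ + (n₂ : K) * (C.thetaForm s).a₂))
      = y * ((C.thetaForm s).a₁ * (C.thetaForm s).a₂) := by
  have key : y ^ 2 * (x * (((m₁ : K) * (C.thetaForm s).a₁ + (n₁ : K) * (C.thetaForm s).a₂)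
      * ((m₂ : K) * (C.thetaForm s).a₁ + (n₂ : K) * (C.thetaForm s).a₂))
        - y * ((C.thetaForm s).a₁ * (C.thetaForm s).a₂)) = 0 := by
    linear_combination (-(x ^ 2 * (C'.thetaForm s).a₂)) * h₁
      - (x * y * ((m₁ : K) * (C.thetaForm s).a₁ + (n₁ : K) * (C.thetaForm s).a₂)) * h₂ + hδ
  rcases mul_eq_zero.mp key with h | h
  · exact absurd h (pow_ne_zero 2 hy)
  · exact sub_eq_zero.mp h

/-- **`det M = 1`: the pair of `C'` is that of `C ∘ M`, so `C' = C ∘ M`** (`SL₂(ℤ)`-equivalent).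
[cite: Bhargava2004HCL1, §3.4 (Theorem 13: the triple determines the SL₂(ℤ)-orbit)] -/
theorem sl2zEquiv_of_transition (hdet : m₁ * n₂ - n₁ * m₂ = 1) : SL2ZEquiv C C' := by
  set γ : Matrix (Fin 2) (Fin 2) ℤ := !![m₁, n₁; m₂, n₂] with hγ_def
  have hγ : γ.det = 1 := by rw [hγ_def, Matrix.det_fin_two_of]; linear_combination hdet
  refine ⟨γ, hγ, ?_⟩
  obtain ⟨-, e1, e2, -⟩ := delta_mul_thetaForm_subst C hs γ hγ
  have hγ00 : γ 0 0 = m₁ := rfl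
  have hγ01 : γ 0 1 = n₁ := rfl
  have hγ10 : γ 1 0 = m₂ := rfl
  have hγ11 : γ 1 1 = n₂ := rfl
  simp only [hγ00, hγ01, hγ10, hγ11] at e1 e2
  set T := C.thetaForm s with hT
  set T' := C'.thetaForm s with hT'
  set ψ := (C.subst γ).thetaForm s with hψ
  set α' := (m₁ : K) * T.a₁ + (n₁ : K) * T.a₂ with hα'
  set β' := (m₂ : K) * T.a₁ + (n₂ : K) * T.a₂ with hβ'
  have hR := x_mul_basis_eq C C' m₁ n₁ m₂ n₂ hy h₁ h₂ hδ
  have hδ0 : T.a₁ * T.a₂ ≠ 0 := thetaForm_a₁_mul_a₂_ne_zero C hs hD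
  have hs' : s ^ 2 = (C'.disc : K) := by rw [hdisc]; exact hs
  have hD' : ¬ IsSquare C'.disc := by rw [hdisc]; exact hD
  have hsγ : s ^ 2 = ((C.subst γ).disc : K) := by rw [disc_subst_of_det_eq_one C γ hγ]; exact hs
  have hT'₁ : T'.a₁ ≠ 0 := thetaForm_a₁_ne_zero C' hs' hD'
  have hT'₂ : T'.a₂ ≠ 0 := thetaForm_a₂_ne_zero C' hs' hD'
  have hC'02 : T'.a₀ * T'.a₂ = T'.a₁ ^ 2 := thetaForm_a₀_mul_a₂ C' hs'
  have hC'13 : T'.a₁ * T'.a₃ = T'.a₂ ^ 2 := thetaForm_a₁_mul_a₃ C' hs'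
  have hψ02 : ψ.a₀ * ψ.a₂ = ψ.a₁ ^ 2 := thetaForm_a₀_mul_a₂ (C.subst γ) hsγ
  have hψ13 : ψ.a₁ * ψ.a₃ = ψ.a₂ ^ 2 := thetaForm_a₁_mul_a₃ (C.subst γ) hsγ
  -- `θ'ᵢ = ψᵢ`
  have f1 : T'.a₁ = ψ.a₁ := by
    have : x * (T.a₁ * T.a₂) * (T'.a₁ - ψ.a₁) = 0 := by
      linear_combination (T.a₁ * T.a₂) * h₁ - x * e1 - α' * hR
    rcases mul_eq_zero.mp this with h | h
    · exact absurd h (mul_ne_zero hx hδ0)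
    · exact sub_eq_zero.mp h
  have f2 : T'.a₂ = ψ.a₂ := by
    have : x * (T.a₁ * T.a₂) * (T'.a₂ - ψ.a₂) = 0 := by
      linear_combination (T.a₁ * T.a₂) * h₂ - x * e2 - β' * hR
    rcases mul_eq_zero.mp this with h | h
    · exact absurd h (mul_ne_zero hx hδ0)
    · exact sub_eq_zero.mp h
  have f0 : T'.a₀ = ψ.a₀ := by
    have : (T'.a₀ - ψ.a₀) * T'.a₂ = 0 := by
      have e := hψ02; rw [← f1, ← f2] at e
      linear_combination hC'02 - e
    rcases mul_eq_zero.mp this with h | h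
    · exact sub_eq_zero.mp h
    · exact absurd h hT'₂
  have f3 : T'.a₃ = ψ.a₃ := by
    have : T'.a₁ * (T'.a₃ - ψ.a₃) = 0 := by
      have e := hψ13; rw [← f1, ← f2] at e
      linear_combination hC'13 - e
    rcases mul_eq_zero.mp this with h | h
    · exact absurd h hT'₁
    · exact sub_eq_zero.mp h
  -- equal values, equal coefficients
  simp only [hT', hψ, thetaForm_a₀, thetaForm_a₁, thetaForm_a₂, thetaForm_a₃] at f0 f1 f2 f3
  obtain ⟨a0, -⟩ := parts_eq_of_thetaForm_eq hD hs f0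
  obtain ⟨a1, -⟩ := parts_eq_of_thetaForm_eq hD hs f1
  obtain ⟨a2, -⟩ := parts_eq_of_thetaForm_eq hD hs f2
  obtain ⟨a3, -⟩ := parts_eq_of_thetaForm_eq hD hs f3
  exact SymCubic.ext a0 a1 a2 a3

/-- **`det M = −1` is impossible** (it would force the cubic covariant of an `SL₂(ℤ)`-translate of
`C` to vanish, i.e. `disc C = 0`): orientation-reversing changes of basis do not relate the pairs
of two forms (cf. Bhargava–Varma Cor. 11: `GL₂(ℤ)` identifies `(𝒪, I, δ)` with its conjugate).
[cite: BhargavaVarma2016, Corollary 11 (GL₂(ℤ)- versus SL₂(ℤ)-orbits and conjugation)] -/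
theorem false_of_transition_of_det_eq_neg_one (hdet : m₁ * n₂ - n₁ * m₂ = -1) : False := by
  set γ : Matrix (Fin 2) (Fin 2) ℤ := !![m₁, n₁; -m₂, -n₂] with hγ_def
  have hγ : γ.det = 1 := by rw [hγ_def, Matrix.det_fin_two_of]; linear_combination -hdet
  obtain ⟨-, e1, e2, -⟩ := delta_mul_thetaForm_subst C hs γ hγ
  have hγ00 : γ 0 0 = m₁ := rfl
  have hγ01 : γ 0 1 = n₁ := rfl
  have hγ10 : γ 1 0 = -m₂ := rfl
  have hγ11 : γ 1 1 = -n₂ := rfl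
  simp only [hγ00, hγ01, hγ10, hγ11, Int.cast_neg] at e1 e2
  set T := C.thetaForm s with hT
  set T' := C'.thetaForm s with hT'
  set ψ := (C.subst γ).thetaForm s with hψ
  set α' := (m₁ : K) * T.a₁ + (n₁ : K) * T.a₂ with hα'
  set β' := (m₂ : K) * T.a₁ + (n₂ : K) * T.a₂ with hβ'
  have hR := x_mul_basis_eq C C' m₁ n₁ m₂ n₂ hy h₁ h₂ hδ
  have hδ0 : T.a₁ * T.a₂ ≠ 0 := thetaForm_a₁_mul_a₂_ne_zero C hs hD
  have hs' : s ^ 2 = (C'.disc : K) := by rw [hdisc]; exact hs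
  have hD' : ¬ IsSquare C'.disc := by rw [hdisc]; exact hD
  have hdγ : (C.subst γ).disc = C.disc := disc_subst_of_det_eq_one C γ hγ
  have hsγ : s ^ 2 = ((C.subst γ).disc : K) := by rw [hdγ]; exact hs
  have hT'₁ : T'.a₁ ≠ 0 := thetaForm_a₁_ne_zero C' hs' hD'
  have hT'₂ : T'.a₂ ≠ 0 := thetaForm_a₂_ne_zero C' hs' hD'
  have hC'02 : T'.a₀ * T'.a₂ = T'.a₁ ^ 2 := thetaForm_a₀_mul_a₂ C' hs'
  have hC'13 : T'.a₁ * T'.a₃ = T'.a₂ ^ 2 := thetaForm_a₁_mul_a₃ C' hs'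
  have hψ02 : ψ.a₀ * ψ.a₂ = ψ.a₁ ^ 2 := thetaForm_a₀_mul_a₂ (C.subst γ) hsγ
  have hψ13 : ψ.a₁ * ψ.a₃ = ψ.a₂ ^ 2 := thetaForm_a₁_mul_a₃ (C.subst γ) hsγ
  -- `θ' = (ψ₀, −ψ₁, ψ₂, −ψ₃)`
  have f1 : T'.a₁ = -ψ.a₁ := by
    have : x * (T.a₁ * T.a₂) * (T'.a₁ + ψ.a₁) = 0 := by
      linear_combination (T.a₁ * T.a₂) * h₁ + x * e1 - α' * hR
    rcases mul_eq_zero.mp this with h | h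
    · exact absurd h (mul_ne_zero hx hδ0)
    · exact eq_neg_of_add_eq_zero_left h
  have f2 : T'.a₂ = ψ.a₂ := by
    have : x * (T.a₁ * T.a₂) * (T'.a₂ - ψ.a₂) = 0 := by
      linear_combination (T.a₁ * T.a₂) * h₂ - x * e2 - β' * hR
    rcases mul_eq_zero.mp this with h | h
    · exact absurd h (mul_ne_zero hx hδ0)
    · exact sub_eq_zero.mp h
  have f0 : T'.a₀ = ψ.a₀ := by
    have : (T'.a₀ - ψ.a₀) * T'.a₂ = 0 := by
      have e := hψ02
      rw [← f2, show ψ.a₁ = -T'.a₁ by rw [f1, neg_neg]] at e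
      linear_combination hC'02 - e
    rcases mul_eq_zero.mp this with h | h
    · exact sub_eq_zero.mp h
    · exact absurd h hT'₂
  have f3 : T'.a₃ = -ψ.a₃ := by
    have : T'.a₁ * (T'.a₃ + ψ.a₃) = 0 := by
      have e := hψ13
      rw [← f2, show ψ.a₁ = -T'.a₁ by rw [f1, neg_neg]] at e
      linear_combination hC'13 - e
    rcases mul_eq_zero.mp this with h | h
    · exact absurd h hT'₁
    · exact eq_neg_of_add_eq_zero_left h
  -- coefficients and `g`-parts
  simp only [hT', hψ, thetaForm_a₀, thetaForm_a₁, thetaForm_a₂, thetaForm_a₃] at f0 f1 f2 f3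
  obtain ⟨a0, g0⟩ := parts_eq_of_thetaForm_eq hD hs f0
  obtain ⟨a1, g1⟩ := parts_eq_neg_of_thetaForm_eq_neg hD hs f1
  obtain ⟨a2, g2⟩ := parts_eq_of_thetaForm_eq hD hs f2
  obtain ⟨a3, g3⟩ := parts_eq_neg_of_thetaForm_eq_neg hD hs f3
  -- `C' = (C ∘ γ) ∘ J`, `J = diag(1, −1)`
  set J : Matrix (Fin 2) (Fin 2) ℤ := !![1, 0; 0, -1] with hJ_def
  have hJ00 : J 0 0 = 1 := rfl
  have hJ01 : J 0 1 = 0 := rfl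
  have hJ10 : J 1 0 = 0 := rfl
  have hJ11 : J 1 1 = -1 := rfl
  have hJ : J.det = -1 := by rw [hJ_def, Matrix.det_fin_two_of]; norm_num
  have sJ : ∀ F : SymCubic ℤ, F.subst J = ⟨F.a₀, -F.a₁, F.a₂, -F.a₃⟩ := fun F => by
    ext <;> simp only [subst, hJ00, hJ01, hJ10, hJ11] <;> ring
  have hC' : C' = (C.subst γ).subst J := by
    rw [sJ]
    exact SymCubic.ext a0 a1 a2 a3
  -- the cubic covariant of `C ∘ γ` vanishes
  have hg := gCov_subst (C.subst γ) J
  rw [← hC', hJ, sJ] at hg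
  have k0 := congrArg SymCubic.a₀ hg
  have k1 := congrArg SymCubic.a₁ hg
  have k2 := congrArg SymCubic.a₂ hg
  have k3 := congrArg SymCubic.a₃ hg
  simp only [smul_a₀, smul_a₁, smul_a₂, smul_a₃] at k0 k1 k2 k3
  norm_num at k0 k1 k2 k3
  have z0 : (C.subst γ).gCov.a₀ = 0 := by omega
  have z1 : (C.subst γ).gCov.a₁ = 0 := by omega
  have z2 : (C.subst γ).gCov.a₂ = 0 := by omega
  have z3 : (C.subst γ).gCov.a₃ = 0 := by omega
  have hdg := disc_gCov (C.subst γ)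
  have hz : (C.subst γ).gCov.disc = 0 := by
    rw [disc, z0, z1, z2, z3]; ring
  rw [hz, hdγ] at hdg
  have hD0 : C.disc = 0 := pow_eq_zero_iff (n := 3) (by norm_num) |>.mp hdg.symm
  exact hD ⟨0, by rw [hD0, mul_zero]⟩

/-- **Injectivity of the orbit ↦ pair map, field level**: if the pairs `(I, δ)` of `C'` and `C` are
related by a transition matrix `M ∈ GL₂(ℤ)` and a scalar `κ = y/x` — `xθ'ᵢ = y(Mθ)ᵢ`,
`x³δ' = y³δ` — then `C' ∼ C` under `SL₂(ℤ)` (and `det M = 1`). [cite: Bhargava2004HCL1, §3.4 (Theorem 13, injectivity on SL₂(ℤ)-orbits)] -/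
theorem sl2zEquiv_of_transition_of_isUnit (hdet : IsUnit (m₁ * n₂ - n₁ * m₂)) : SL2ZEquiv C C' := by
  rcases Int.isUnit_iff.mp hdet with h | h
  · exact sl2zEquiv_of_transition C C' hs hdisc hD m₁ n₁ m₂ n₂ hx hy h₁ h₂ hδ h
  · exact (false_of_transition_of_det_eq_neg_one C C' hs hdisc hD m₁ n₁ m₂ n₂ hx hy h₁ h₂ hδ h).elim

end Transition

end SymCubic

end Literature.NumberTheory.CubicFields
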